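import Literature.Computability.Complexity.CountingGapPProofs
import HarnessLib

/-!
# Sign sums of polynomial-time predicates and a gap normal form for `PP`

Topic `Computability/Complexity` (counting classes). For a relation `R` on pairs `⟨x, u⟩` the
**sign sum** over the coin strings of length `M`,

  `signSum R M x = Σ_{u ∈ {0,1}^M} (-1)^{[⟨x,u⟩ ∈ R]} = 2^M - 2·#{u ∈ {0,1}^M | ⟨x,u⟩ ∈ R}`,

is the (unnormalised) amplitude `⟨0^M| H^{⊗M} U_{(-1)^R} H^{⊗M} |0^M⟩` of the one-query phase
circuit of `R_x` (Deutsch–Jozsa / Aaronson: "apply Hadamard gates to all `n` qubits … and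
postselect on that register being `|0⟩^{⊗n}`", arXiv:quant-ph/0412187 p. 6, where the state
`(2ⁿ - s)|0⟩ + s|1⟩` records the two halves `#f⁻¹(0)`, `#f⁻¹(1)` of such a sum), and the gap
`#rej - #acc` of a majority machine (Fenner–Fortnow–Kurtz 1994, Def. 3.1: `gap_M = #acc - #rej`).
This file records its elementary properties and the **normal form of `PP` consumed by the
post-selected quantum algorithm for `PP ⊆ PostBQP`** (`QuantumComplexity/AaronsonPPScales.lean`
and sequels): every `L ∈ PP` has a witness relation `R ∈ P` and a coin polynomial `q ≥ 3` with

  `x ∈ L ⇒ signSum R (q|x|) x ≤ -2`,  `x ∉ L ⇒ 2 ≤ signSum R (q|x|) x`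

(`exists_signSum_of_mem_PP`) — Aaronson's "as a technicality, we can guarantee using padding that
`s > 0`" in the two-sided form needed when the sign of the gap, rather than `s < 2^{n-1}`, is
tested: the gap is never `0` and `|x|`-uniformly bounded away from it. The padding relation on
coins `b₁ b₂ b₃ y` accepts `0 b₂ b₃ y` iff `⟨x, y⟩ ∈ L'` and `1 0 b₃ y` iff `b₃ y ≠ 0…0`
(`exists_shiftRel`: `#_R = 4·#_{L'} + 2^{m+1} - 1`, so `signSum R (m+3) = 4·signSum L' m + 2`), built
with `PPGapP.exists_sumRel` and the padding relation of `PPSharpP.exists_msbRel` from `FP`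
preimages, `⊓`, `⊔` of `P` languages (no machine is written).

* `signSum`, `signSum_eq_sum_vector` / `signSum_eq_sum_fin` (the `±1` sum over `List.Vector Bool M`
  and over `Fin M → Bool`, the register type `QReg M` of the quantum files), `abs_signSum_le`,
  `signSum_compl` (`Rᶜ` negates the sum), `signSum_nonneg_iff` (link with Gill's majority:
  `0 ≤ signSum ↔ ¬ 2^M < 2·#`);
* `exists_shiftRel`, `exists_signSum_of_mem_PP`.

## References

* S. Aaronson, *Quantum computing, postselection, and probabilistic polynomial-time*, Proc. R.
  Soc. A 461 (2005) 3473–3482, arXiv:quant-ph/0412187, proof of Thm. 4 (p. 6).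
* S. Fenner, L. Fortnow, S. Kurtz, *Gap-definable counting classes*, J. Comput. System Sci. 48
  (1994) 116–148, Def. 3.1, Proposition 3.5 (branching machines), Proposition 4.2(1).
* J. Gill, *Computational complexity of probabilistic Turing machines*, SIAM J. Comput. 6 (1977),
  Def. 5.1 (`PP`).
-/

noncomputable section

namespace Literature.Computability.Complexity

open _root_.Computability Polynomial TTClosure PPSharpP PPGapP Finset

namespace PPSignSum

/-! ### The sign sum -/

/-- **The sign sum** of the relation `R` over the coin strings of length `M`:
`Σ_{u ∈ {0,1}^M} (-1)^{[⟨x,u⟩ ∈ R]} = 2^M - 2·#{u | ⟨x,u⟩ ∈ R}` (as an integer).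
[cite: FennerFortnowKurtz1994, Def. 3.1] -/
def signSum (R : Language Bool) (M : ℕ) (x : List Bool) : ℤ :=
  (2 : ℤ) ^ M - 2 * (countWitnesses R M x : ℤ)

/-- Unfolding `signSum`. [folklore] -/
theorem signSum_eq (R : Language Bool) (M : ℕ) (x : List Bool) :
    signSum R M x = (2 : ℤ) ^ M - 2 * (countWitnesses R M x : ℤ) := rfl

/-- `|signSum R M x| ≤ 2^M` (`0 ≤ # ≤ 2^M`). [folklore] -/
theorem abs_signSum_le (R : Language Bool) (M : ℕ) (x : List Bool) : |signSum R M x| ≤ 2 ^ M := by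
  have h := cnt_le M {y | boolPair x y ∈ R}
  rw [← countWitnesses_eq_cnt] at h
  have h' : (countWitnesses R M x : ℤ) ≤ 2 ^ M := by exact_mod_cast h
  have h0 : (0 : ℤ) ≤ countWitnesses R M x := by positivity
  rw [signSum_eq, abs_le]
  constructor <;> linarith

/-- **The complement negates the sign sum**: `signSum Rᶜ M x = - signSum R M x`
(`#_R + #_{Rᶜ} = 2^M`). [cite: FennerFortnowKurtz1994, Def. 3.1] -/
theorem signSum_compl (R : Language Bool) (M : ℕ) (x : List Bool) : signSum Rᶜ M x = -signSum R M x := by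
  have h := countWitnesses_add_compl R M x
  have h' : (countWitnesses R M x : ℤ) + countWitnesses Rᶜ M x = 2 ^ M := by exact_mod_cast h
  rw [signSum_eq, signSum_eq]
  linarith

/-- **Link with Gill's majority**: `0 ≤ signSum R M x ↔ ¬ (2^M < 2·#_R)`. [cite: Gill1977, Def. 5.1] -/
theorem signSum_nonneg_iff (R : Language Bool) (M : ℕ) (x : List Bool) :
    0 ≤ signSum R M x ↔ ¬ 2 ^ M < 2 * countWitnesses R M x := by
  rw [signSum_eq, sub_nonneg, not_lt]
  constructor
  · intro h; exact_mod_cast h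
  · intro h; exact_mod_cast h

open scoped Classical in
/-- **The sign sum as a `±1` sum over the coin vectors** of length `M`.
[cite: FennerFortnowKurtz1994, Def. 3.1] -/
theorem signSum_eq_sum_vector (R : Language Bool) (M : ℕ) (x : List Bool) :
    signSum R M x = ∑ r : List.Vector Bool M, (if boolPair x r.toList ∈ R then (-1 : ℤ) else 1) := by
  have hsplit : ∀ r : List.Vector Bool M, (if boolPair x r.toList ∈ R then (-1 : ℤ) else 1) =
      1 - 2 * (if boolPair x r.toList ∈ R then (1 : ℤ) else 0) := fun r => by
    split_ifs <;> norm_num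
  have hcard : (countWitnesses R M x : ℤ) =
      ∑ r : List.Vector Bool M, (if boolPair x r.toList ∈ R then (1 : ℤ) else 0) := by
    rw [Finset.sum_boole]
    unfold countWitnesses
    rfl
  rw [Finset.sum_congr rfl fun r _ => hsplit r, Finset.sum_sub_distrib, ← Finset.mul_sum, ← hcard,
    Finset.sum_const, Finset.card_univ, card_vector, Fintype.card_bool, signSum_eq]
  simp

open scoped Classical in
/-- **The sign sum as a `±1` sum over `Fin M → Bool`** (the register type of the quantum
files), the coin string being `List.ofFn u`. [cite: FennerFortnowKurtz1994, Def. 3.1] -/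
theorem signSum_eq_sum_fin (R : Language Bool) (M : ℕ) (x : List Bool) :
    signSum R M x = ∑ u : Fin M → Bool, (if boolPair x (List.ofFn u) ∈ R then (-1 : ℤ) else 1) := by
  rw [signSum_eq_sum_vector]
  refine Fintype.sum_equiv (Equiv.vectorEquivFin Bool M) _ _ fun r => ?_
  have hr : List.ofFn ((Equiv.vectorEquivFin Bool M) r) = r.toList := by
    rw [← List.Vector.toList_ofFn]
    exact congrArg List.Vector.toList (List.Vector.ofFn_get r)
  rw [hr]

/-! ### The shift relation -/

/-- Dropping two leading coins multiplies the count by four. [folklore] -/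
theorem cnt_drop_two (m : ℕ) (E : Set (List Bool)) : cnt (m + 2) {y | y.drop 2 ∈ E} = 4 * cnt m E := by
  rw [cnt_succ, cnt_succ, cnt_succ]
  have h : ∀ a b : Bool, cnt m {y : List Bool | b :: y ∈ {y : List Bool | a :: y ∈ {y : List Bool | y.drop 2 ∈ E}}} = cnt m E :=
    fun a b => cnt_congr fun y _ => by simp
  rw [h, h, h, h]
  ring

/-- **The shift relation.** For `L' ∈ P` there is `R ∈ P` whose witnesses of length `m + 3` are
counted by `#_R(x) = 4·#_{L'}(x) + (2^{m+1} - 1)`: on coins `b₁ b₂ b₃ y`, accept `0 b₂ b₃ y` iff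
`⟨x, y⟩ ∈ L'`, accept `1 0 b₃ y` iff `1 ∈ b₃ y`, reject `1 1 b₃ y` (branch once on `b₁`:
Fenner–Fortnow–Kurtz's branching machines, `PPGapP.exists_sumRel`, between `drop₂⁻¹ L'` and the
padding relation `Pad = {⟨x, 0z⟩ | 1 ∈ z}` of `PPSharpP.exists_msbRel`, whose count `2^{m+1} - 1`
is `cnt_pad_succ`). [cite: FennerFortnowKurtz1994, Proposition 3.5 (proof)] -/
theorem exists_shiftRel {L' : Language Bool} (hL' : L' ∈ Classes.P) :
    ∃ R ∈ Classes.P, ∀ (m : ℕ) (x : List Bool),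
      countWitnesses R (m + 3) x + 1 = 4 * countWitnesses L' m x + 2 ^ (m + 1) := by
  -- `L₀ = drop₂⁻¹ L'`, `Pad = Tag₀ ⊓ (1 ∈ coins)`
  set L₀ : Language Bool := dropSndFn 2 ⁻¹' L' with hL₀def
  set Tag0 : Language Bool := (sndP ∘ truncSndFn 1) ⁻¹' NoBit true with hTag0
  set Pad : Language Bool := Tag0 ⊓ (sndP ⁻¹' HasBit true) with hPad
  have hL₀ : L₀ ∈ Classes.P := preimage_mem_P hL' (dropSndFn_mem_FP 2)
  have hTag0P : Tag0 ∈ Classes.P :=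
    preimage_mem_P (NoBit_mem_P true) (comp_mem_FP sndP_mem_FP (truncSndFn_mem_FP 1))
  have hPadP : Pad ∈ Classes.P := inter_mem_P hTag0P (preimage_mem_P (HasBit_mem_P true) sndP_mem_FP)
  obtain ⟨R, hR, hR0, hR1⟩ := exists_sumRel hL₀ hPadP
  refine ⟨R, hR, fun m x => ?_⟩
  have hdrop : ∀ y : List Bool, dropSndFn 2 (boolPair x y) = boolPair x (y.drop 2) := fun y => by
    rw [dropSndFn_boolPair]; simp
  have hPadIff : ∀ y : List Bool, boolPair x y ∈ Pad ↔ true ∉ y.take 1 ∧ true ∈ y := by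
    intro y
    rw [hPad, Language.mem_inf, hTag0, memL_preimage, memL_preimage, Function.comp_apply,
      truncSndFn_boolPair, eval_one, sndP_boolPair, sndP_boolPair, mem_NoBit, mem_HasBit]
  -- count of `L₀`
  have hc0 : countWitnesses L₀ (m + 2) x = 4 * countWitnesses L' m x := by
    rw [countWitnesses_eq_cnt, countWitnesses_eq_cnt, ← cnt_drop_two]
    exact cnt_congr fun y _ => by simp only [Set.mem_setOf_eq, hL₀def, memL_preimage, hdrop]
  -- count of `Pad`
  have hc1 : countWitnesses Pad (m + 2) x + 1 = 2 ^ (m + 1) := by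
    have h := cnt_congr (m := m + 2) (E := {y | boolPair x y ∈ Pad})
      (E' := {y : List Bool | true ∉ y.take 1 ∧ true ∈ y}) fun y _ => by
        simp only [Set.mem_setOf_eq, hPadIff]
    rw [countWitnesses_eq_cnt, h]
    exact cnt_pad_succ (m + 1)
  rw [countWitnesses_sumRel hR0 hR1 (m + 2) x, hc0, add_assoc, hc1]

/-- **The sign sum of the shift relation**: `signSum R (m+3) x = 4·signSum L' m x + 2`.
[cite: FennerFortnowKurtz1994, Proposition 3.5 (proof)] -/
theorem signSum_of_shift {R L' : Language Bool} {m : ℕ} {x : List Bool}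
    (h : countWitnesses R (m + 3) x + 1 = 4 * countWitnesses L' m x + 2 ^ (m + 1)) :
    signSum R (m + 3) x = 4 * signSum L' m x + 2 := by
  have h' : (countWitnesses R (m + 3) x : ℤ) + 1 = 4 * countWitnesses L' m x + 2 ^ (m + 1) := by
    exact_mod_cast h
  rw [signSum_eq, signSum_eq, pow_succ, pow_succ, pow_succ]
  rw [pow_succ] at h'
  linarith

/-! ### The normal form of `PP` -/

/-- **Gap normal form of `PP`.** Every `L ∈ PP` has a witness relation `R ∈ P` and a coin
polynomial `q` with `q ≥ 3` such that the sign sum is `≤ -2` on members and `≥ 2` on non-members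
(in particular never `0`): from Gill's majority relation `L'` with `p` coins
(`x ∈ L ↔ 2^{p|x|} < 2·#_{L'}`, i.e. `signSum L' ≤ -1` on members — indeed `≤ -2` unless `p|x| = 0` —
and `≥ 0` off `L`) pass to the shift relation of `exists_shiftRel` with `q = p + 3`:
`signSum R = 4·signSum L' + 2`. (Aaronson 2005, proof of Thm. 4: "we can guarantee using padding
that `s > 0`"; Fenner–Fortnow–Kurtz 1994, Proposition 4.2(1): `x ∈ L ⟺ gap > 0`.)
[cite: Aaronson2005, Thm. 4 (proof)] [cite: FennerFortnowKurtz1994, Proposition 4.2(1)] -/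
theorem exists_signSum_of_mem_PP {L : Language Bool} (hL : L ∈ PP) :
    ∃ R ∈ Classes.P, ∃ q : Polynomial ℕ, (∀ n, 3 ≤ q.eval n) ∧ ∀ x : List Bool,
      (x ∈ L → signSum R (q.eval x.length) x ≤ -2) ∧ (x ∉ L → 2 ≤ signSum R (q.eval x.length) x) := by
  obtain ⟨L', hL', p, hp⟩ := hL
  obtain ⟨R, hR, hshift⟩ := exists_shiftRel hL'
  refine ⟨R, hR, p + 3, fun n => by simp, fun x => ?_⟩
  have e3 : (p + 3 : Polynomial ℕ).eval x.length = p.eval x.length + 3 := by simp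
  rw [e3, signSum_of_shift (hshift (p.eval x.length) x)]
  have hmem : x ∈ L ↔ 2 ^ p.eval x.length < 2 * countWitnesses L' (p.eval x.length) x := by
    rw [hp x, half_lt_uniformProb_iff, countWitnesses_eq_cnt]
  have hnn := signSum_nonneg_iff L' (p.eval x.length) x
  constructor
  · intro hx
    have h1 : signSum L' (p.eval x.length) x < 0 := by
      by_contra h
      exact (hnn.1 (not_lt.1 h)) (hmem.1 hx)
    have h2 : signSum L' (p.eval x.length) x ≤ -1 := by linarith [Int.add_one_le_iff.2 h1]
    linarith
  · intro hx
    have h1 : 0 ≤ signSum L' (p.eval x.length) x := hnn.2 (fun h => hx (hmem.2 h))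
    linarith

end PPSignSum

end Literature.Computability.Complexity

end
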